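import Literature.IUT.HodgeArakelov.MonoThetaCyclotomes
import Literature.IUT.HodgeArakelov.RadialEnvironments

/-!
# [IUTchII] §1, Example 1.8: radial and coric data II — concrete examples

Mochizuki, *Inter-universal Teichmüller theory II*, §1, Example 1.8 (i)–(ix) and Remark 1.8.1, kurims
manuscript (Dec. 2020) pp. 35–42 [claim: Mochizuki2012, status: disputed] (IUTchII §1 Ex 1.8, kurims pp.35-42).
Record-only typing under the claim key `Mochizuki2012` (D-0012, disputed).

Every radial environment of Example 1.8 has the same SHAPE: a collection of radial data is a pair
("`Π`-side output", "`G`-side output") — the comparison `α` being a full poly-isomorphism, resp. a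
`Γ`-orbit of poly-isomorphisms, i.e. NO extra datum — an isomorphism of radial data is a pair of
isomorphisms ("which are necessarily compatible with `α, α*`!"), the coric data is the `G`-side output,
and the radial algorithm is the second projection. We therefore DEFINE (real category theory, continuing
`RadialEnvironments`):
* `IsoClass P` — the groupoid of topological groups isomorphic to `P` (morphisms: isomorphisms of
  topological groups) = the input category of a "functorial group-theoretic algorithm";
* `TwistedIsoClass P Γ` — the same objects with morphisms "a `Γ`-multiple of the isomorphism induced by an
  isomorphism of topological groups" (pairs `(e, γ)`), for an abstract group `Γ` (a closed subgroup
  `Γ ⊆ Ẑ^×`, `Γ^{×μ} ⊆ Ism`, … in the text);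
* `pairEnvironment E C` — radial data `E × C`, coric data `C`, radial functor the projection; PROVED
  multiradial as soon as `E` is connected (`pairEnvironment_isMultiradial`) — this discharges the printed
  "whose associated radial functor is full and essentially surjective, hence determines a multiradial
  environment" of (i), (ii), (iii), (v), (viii) uniformly;
* `IUTchII:Ex1.8(i)` `(Π, G, α)` — `ex18i` (PROVED multiradial); `IUTchII:Ex1.8(ii)` — `ex18ii` over interface
  groupoids of TM-pairs; `IUTchII:Ex1.8(iii)` — `ex18iii S Γ` (PROVED multiradial);
* `IUTchII:Ex1.8(iv)`–`(ix)` — NOT separate definitions: by Ex. 1.9 (i) each has, up to equivalence, the shape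
  `ex18iii S Γ` for the appropriate twisting group (see the section docstring at the end); the OUTPUT DATA
  (`M_TM`, `O^{×μ}`, `O^ĝp`, `Ism`, log-shells …) are [AbsTopIII] outputs and live in the interface file
  `AbsTopInterfaces.lean` (TODO-merge:abc-iut-L4-t2 / abc-iut-L4-t3), together with `IUTchII:Rmk1.8.1`.

MORPHISM MODEL (review note): the printed isomorphisms of coric data are "`Γ`-multiples of the isomorphism
induced by an isomorphism of topological groups `G ≅ G*`", i.e. composite maps of the output data; we take the
PAIRS `(e, γ)` (`TwistedIsoClass`), a priori a finer groupoid of which the printed one is a quotient (Remark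
1.8.1 says the two agree on the `ℤ_p^×`-nontrivial part). Fullness of a projection functor is insensitive to
passing to that quotient, so the multiradiality statements are unaffected. Underline caveat as in
`MonoThetaCyclotomes`.
-/

namespace Literature.IUT.HodgeArakelov

open CategoryTheory

universe u v w

/-! ## The groupoid of isomorphs of a topological group -/

/-- The objects of the input category of a "functorial group-theoretic algorithm": "a topological group
`Π` isomorphic to `Π^tp_{X̲̲_k}`" / "a topological group `G` isomorphic to `G_k`" (Ex. 1.8 (i)).
[claim: Mochizuki2012, status: disputed] (IUTchII §1 Ex 1.8 (i), kurims p.35) -/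
structure IsoClass (P : TopGroup.{u}) : Type (u + 1) where
  /-- the topological group -/
  G : TopGroup.{u}
  iso : Nonempty (G ≃ₜ* P)

namespace IsoClass

variable {P : TopGroup.{u}}

/-- `IsoClass P` is a groupoid: morphisms are isomorphisms of topological groups ("isomorphisms of
topological groups `Π ≅ Π*`", Ex. 1.8 (i)). [claim: Mochizuki2012, status: disputed] (IUTchII §1 Ex 1.8 (i), kurims p.36) -/
instance : Groupoid.{u} (IsoClass P) where
  Hom X Y := X.G ≃ₜ* Y.G
  id X := ContinuousMulEquiv.refl X.G
  comp f g := f.trans g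
  id_comp _ := ContinuousMulEquiv.ext fun _ => rfl
  comp_id _ := ContinuousMulEquiv.ext fun _ => rfl
  assoc _ _ _ := ContinuousMulEquiv.ext fun _ => rfl
  inv f := f.symm
  inv_comp f := ContinuousMulEquiv.ext fun x => f.apply_symm_apply x
  comp_inv f := ContinuousMulEquiv.ext fun x => f.symm_apply_apply x

/-- A morphism of `IsoClass P` viewed as the isomorphism of topological groups it is.
[claim: Mochizuki2012, status: disputed] (IUTchII §1 Ex 1.8 (i), kurims p.36) -/
abbrev homIso {X Y : IsoClass P} (f : X ⟶ Y) : X.G ≃ₜ* Y.G := f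

/-- The reference object. [claim: Mochizuki2012, status: disputed] (IUTchII §1 Ex 1.8 (i), kurims p.35) -/
def base (P : TopGroup.{u}) : IsoClass P := ⟨P, ⟨ContinuousMulEquiv.refl P⟩⟩

/-- `IsoClass P` is connected: any two isomorphs of `P` are isomorphic (PROVED).
[claim: Mochizuki2012, status: disputed] (IUTchII §1 Ex 1.8 (i), kurims p.36) -/
theorem nonempty_hom (X Y : IsoClass P) : Nonempty (X ⟶ Y) := by
  obtain ⟨e⟩ := X.iso
  obtain ⟨f⟩ := Y.iso
  exact ⟨e.trans f.symm⟩

end IsoClass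

/-- **IUTchII:Ex1.8(iii)** shape: isomorphs of `P` with morphisms "a `Γ`-multiple of the isomorphism …
induced by an isomorphism of topological groups `G ≅ G*`" (kurims p. 38), `Γ` an abstract group (in the
text a closed subgroup `Γ ⊆ Ẑ^×`, or `Γ^{×μ} ⊆ Ism(-)` in (iv)); morphisms are pairs `(e, γ)`.
[claim: Mochizuki2012, status: disputed] (IUTchII §1 Ex 1.8 (iii), kurims p.38) -/
structure TwistedIsoClass (P : TopGroup.{u}) (Γ : Type u) [Group Γ] : Type (u + 1) where
  /-- the topological group -/
  G : TopGroup.{u}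
  iso : Nonempty (G ≃ₜ* P)

namespace TwistedIsoClass

variable {P : TopGroup.{u}} {Γ : Type u} [Group Γ]

/-- Morphisms `(e, γ)`: an isomorphism of topological groups and an element of `Γ`.
[claim: Mochizuki2012, status: disputed] (IUTchII §1 Ex 1.8 (iii), kurims p.38) -/
@[ext]
structure Hom (X Y : TwistedIsoClass P Γ) : Type u where
  /-- the inducing isomorphism of topological groups -/
  iso : X.G ≃ₜ* Y.G
  /-- the `Γ`-twist -/
  twist : Γ

/-- `TwistedIsoClass P Γ` is a groupoid. [claim: Mochizuki2012, status: disputed] (IUTchII §1 Ex 1.8 (iii), kurims p.38) -/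
instance : Groupoid.{u} (TwistedIsoClass P Γ) where
  Hom := Hom
  id X := ⟨ContinuousMulEquiv.refl X.G, 1⟩
  comp f g := ⟨f.iso.trans g.iso, f.twist * g.twist⟩
  id_comp _ := Hom.ext (ContinuousMulEquiv.ext fun _ => rfl) (one_mul _)
  comp_id _ := Hom.ext (ContinuousMulEquiv.ext fun _ => rfl) (mul_one _)
  assoc _ _ _ := Hom.ext (ContinuousMulEquiv.ext fun _ => rfl) (mul_assoc _ _ _)
  inv f := ⟨f.iso.symm, f.twist⁻¹⟩
  inv_comp f := Hom.ext (ContinuousMulEquiv.ext fun x => f.iso.apply_symm_apply x) (inv_mul_cancel _)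
  comp_inv f := Hom.ext (ContinuousMulEquiv.ext fun x => f.iso.symm_apply_apply x) (mul_inv_cancel _)

/-- `TwistedIsoClass P Γ` is connected (PROVED). [claim: Mochizuki2012, status: disputed] (IUTchII §1 Ex 1.8 (iii), kurims p.38) -/
theorem nonempty_hom (X Y : TwistedIsoClass P Γ) : Nonempty (X ⟶ Y) := by
  obtain ⟨e⟩ := X.iso
  obtain ⟨f⟩ := Y.iso
  exact ⟨⟨e.trans f.symm, 1⟩⟩

end TwistedIsoClass

/-! ## The common shape of the Example 1.8 environments -/

/-- The radial environment with radial data `E × C` (pairs; the comparison `α` being a full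
poly-isomorphism / `Γ`-orbit carries no datum), coric data `C`, radial algorithm the projection
`(R, C) ↦ C` — the common shape of Example 1.8 (i)–(ix) ("An isomorphism of collections of radial data …
is defined to be a pair of isomorphisms … [which are necessarily compatible with `α, α*`!] … The radial
algorithm is the algorithm given by the assignment `(Π, G, α) ↦ G`", kurims p. 36).
[claim: Mochizuki2012, status: disputed] (IUTchII §1 Ex 1.8 (i), kurims p.36) -/
def pairEnvironment (E C : Type w) [Groupoid.{v} E] [Groupoid.{v} C] [Nonempty E] :
    RadialEnvironment.{v, w} where
  R := E × C
  C := C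
  Φ := CategoryTheory.Prod.snd E C
  essSurj := ⟨fun c => ⟨(Classical.arbitrary E, c), ⟨Iso.refl c⟩⟩⟩

/-- PROVED: the printed clause "whose associated radial functor is full and essentially surjective, hence
determines a multiradial environment" (kurims pp. 36, 37, 38, 40, 41) for every environment of this shape
whose `Π`-side category is connected. [claim: Mochizuki2012, status: disputed] (IUTchII §1 Ex 1.8 (i), kurims p.36) -/
theorem pairEnvironment_isMultiradial (E C : Type w) [Groupoid.{v} E] [Groupoid.{v} C] [Nonempty E]
    (hE : ∀ X Y : E, Nonempty (X ⟶ Y)) : (pairEnvironment E C).IsMultiradial where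
  map_surjective {X Y} := by
    intro g
    obtain ⟨f⟩ := hE X.1 Y.1
    exact ⟨(f, g), rfl⟩

variable (S : ThetaSetting.{u})

/-! ## Example 1.8 (i) -/

/-- **IUTchII:Ex1.8(i)** (kurims pp. 35–36): "a collection of radial data `(Π, G, α)` [consists] of a
topological group `Π` isomorphic to `Π^tp_{X̲̲_k}`, a topological group `G` isomorphic to `G_k`, and the
full poly-isomorphism `α : Π/Δ ≅ G` … An isomorphism of collections of radial data … is defined to be a
pair of isomorphisms of topological groups `Π ≅ Π*`, `G ≅ G*` [which are necessarily compatible with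
`α, α*`!]. A collection of coric data is defined to be a topological group isomorphic to `G_k`; an
isomorphism of collections of coric data is defined to be an isomorphism of topological groups. The
radial algorithm is … `(Π, G, α) ↦ G`" (Fig. 1.2: "different arithmetic holomorphic structures on a
single coric `G`"). [claim: Mochizuki2012, status: disputed] (IUTchII §1 Ex 1.8 (i), kurims pp.35-36) -/
def ex18i : RadialEnvironment.{u, u + 1} :=
  haveI : Nonempty (IsoClass S.PiX) := ⟨IsoClass.base S.PiX⟩
  pairEnvironment (IsoClass S.PiX) (IsoClass S.Gk)

/-- **IUTchII:Ex1.8(i)**, PROVED: "whose associated radial functor is full and essentially surjective,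
hence determines a multiradial environment." [claim: Mochizuki2012, status: disputed] (IUTchII §1 Ex 1.8 (i), kurims p.36) -/
theorem ex18i_isMultiradial : (ex18i S).IsMultiradial :=
  haveI : Nonempty (IsoClass S.PiX) := ⟨IsoClass.base S.PiX⟩
  pairEnvironment_isMultiradial _ _ IsoClass.nonempty_hom

/-- **IUTchII:Ex1.8(ii)** (kurims pp. 36–37): radial data `(Π ↷ M_TM(Π), G ↷ O^⊳(G), α_⊳)`, `α_⊳` "the
poly-isomorphism of MLF-Galois TM-pairs … determined … by the composite of the natural surjection
`Π ↠ Π/Δ` with the full poly-isomorphism `Π/Δ ≅ G`"; isomorphisms: pairs of isomorphisms of MLF-Galois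
TM-pairs; coric data: `G ↷ O^⊳(G)`; radial algorithm the projection. INTERFACE point: the groupoids of
TM-pairs `(Π ↷ M_TM(Π))`, `(G ↷ O^⊳(G))` with ALL their TM-pair isomorphisms are supplied as connected
groupoids `TMP`, `TMG` (TODO-merge:abc-iut-L4-t2); the environment is then the pair environment.
[claim: Mochizuki2012, status: disputed] (IUTchII §1 Ex 1.8 (ii), kurims pp.36-37) -/
def ex18ii (TMP TMG : Type w) [Groupoid.{v} TMP] [Groupoid.{v} TMG] [Nonempty TMP] :
    RadialEnvironment.{v, w} :=
  pairEnvironment TMP TMG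

/-- **IUTchII:Ex1.8(ii)**, PROVED (given connectedness of the TM-pair groupoid, [AbsTopIII] Cor. 3.6):
"full and essentially surjective, hence determines a multiradial environment."
[claim: Mochizuki2012, status: disputed] (IUTchII §1 Ex 1.8 (ii), kurims p.37) -/
theorem ex18ii_isMultiradial (TMP TMG : Type w) [Groupoid.{v} TMP] [Groupoid.{v} TMG] [Nonempty TMP]
    (h : ∀ X Y : TMP, Nonempty (X ⟶ Y)) : (ex18ii TMP TMG).IsMultiradial :=
  pairEnvironment_isMultiradial _ _ h

/-- **IUTchII:Ex1.8(iii)** (kurims pp. 37–38): for a closed subgroup `Γ ⊆ Ẑ^×`, radial data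
`(Π ↷ M^×_TM(Π), G ↷ O^×(G), α_×)` with `α_×` "determined by the `Γ`-orbit of the poly-isomorphism
`α_⊳|_×`"; isomorphisms: "the isomorphism … induced by an isomorphism of topological groups `Π ≅ Π*`,
together with a `Γ`-multiple of the isomorphism … induced by an isomorphism of topological groups
`G ≅ G*`"; coric data `G ↷ O^×(G)` with `Γ`-multiples of induced isomorphisms; radial algorithm the
projection. DEFINED with `Γ` an abstract group (the text's `Γ ⊆ Ẑ^×`).
[claim: Mochizuki2012, status: disputed] (IUTchII §1 Ex 1.8 (iii), kurims pp.37-38) -/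
def ex18iii (Γ : Type u) [Group Γ] : RadialEnvironment.{u, u + 1} :=
  haveI : Nonempty (IsoClass S.PiX) := ⟨IsoClass.base S.PiX⟩
  pairEnvironment (IsoClass S.PiX) (TwistedIsoClass S.Gk Γ)

/-- **IUTchII:Ex1.8(iii)**, PROVED: "full and essentially surjective, hence determines a multiradial
environment." [claim: Mochizuki2012, status: disputed] (IUTchII §1 Ex 1.8 (iii), kurims p.38) -/
theorem ex18iii_isMultiradial (Γ : Type u) [Group Γ] : (ex18iii S Γ).IsMultiradial :=
  haveI : Nonempty (IsoClass S.PiX) := ⟨IsoClass.base S.PiX⟩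
  pairEnvironment_isMultiradial _ _ IsoClass.nonempty_hom

/-! ## Example 1.8 (iv)–(ix): the same environment shape

By Example 1.9 (i) (the graph of a functorial algorithm on `IsoClass Π` resp. `IsoClass G` is equivalent to its
domain), each of the remaining environments of Example 1.8 has — up to equivalence of its radial and coric
categories — the SHAPE `ex18iii S Γ` for the appropriate twisting group:
* `IUTchII:Ex1.8(iv)` (kurims pp. 38–39): "by replacing the symbol `×` in (iii) by the symbol `μ` or … `×μ`, one
  obtains, respectively, cyclotomic and co-cyclotomic versions of the example treated in (iii)"; in the
  co-cyclotomic case "one may replace the `Γ` in (iii) by such a `Γ^{×μ}`" (a closed subgroup of `Ism(-)`;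
  examples `Ism` itself, `Im(Ẑ^×)`) — shape `ex18iii S Γ^{×μ}`;
* `IUTchII:Ex1.8(v)` (pp. 39–40): radial data `(Π ↷ M^μ_TM(Π), G ↷ O^{×μ}(G), α_{μ,×μ})`, `α_{μ,×μ}` determined by
  the full poly-isomorphism `Π/Δ ≅ G` and the trivial homomorphism — shape `ex18iii S Γ^{×μ}`;
* `IUTchII:Ex1.8(vi)` (p. 40): `M^μ_TM(Π)` replaced by `Π_μ(M^Θ_*(Π)) ⊗ ℚ/ℤ` ("exterior-cyclotomic version") —
  same shape;
* `IUTchII:Ex1.8(vii)` (p. 40): the groupifications `(*gp)`, `(*ĝp)` and the poly-isomorphism `α_ĝp` — no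
  environment; INTERFACE data `ProfiniteGroupifications` (file `AbsTopInterfaces`);
* `IUTchII:Ex1.8(viii)` (pp. 40–41): radial data `(Π ↷ M_TM(Π), G ↷ O^ĝp(G), α_{⊳,×μ})` with the printed diagram
  `M_TM(Π) ↪ M^ĝp_TM(Π) ≅ O^ĝp(G)|_Π ↩ O^×(G)|_Π ↠ O^{×μ}(G)|_Π`, coric data as in (v) with `Γ^{×μ} := Im(Γ)` —
  shape `ex18iii S Γ`;
* `IUTchII:Ex1.8(ix)` (p. 41): the log-shell versions of (v), (vi), (viii) (`G ↷ O^{×μ}(G)` equipped with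
  `I(G) ⊆ O^{×μ}(G)`) — same shapes.
What is NOT typed in this file: the output data themselves — `M_TM(Π)`, `M^μ_TM(Π)`, `O^⊳(G)`, `O^{×μ}(G)`,
`Π_μ(M^Θ_*(Π)) ⊗ ℚ/ℤ`, `O^ĝp(G)`, `Ism(G)`, the log-shell `I(G)` — which are outputs of [AbsTopIII] algorithms
(owners abc-iut-L4-t2/t3); they are carried by the INTERFACE structures `AbsTopMonoids` /
`ProfiniteGroupifications` of `AbsTopInterfaces.lean`, over which Corollaries 1.11, 1.12 are typed. The five
printed sentences "one verifies immediately that one obtains a multiradial environment" are, for the shape,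
the theorem `ex18iii_isMultiradial`. -/

end Literature.IUT.HodgeArakelov
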